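import Literature.AlgebraicGeometry.GroupSchemes.BarsottiTateGroup
import HarnessLib
import HarnessLib.Audit.LibrarySuggestionsDenyListCruxes


/-! ## ★ RE-HOME TWIN (Theorems-purity) — desk F0P6b-plan (g14) cand, 2026-09-03
This file is the token-for-token twin of the crux workfile `Cruxes/HLiu418/Lines/F0_P6b_BTSerreTateDefs.lean` (ED. 1) under the namespace
`Summit.HodgeConjecture.HodgeConjecture.Cruxes.HLiu418.F0P6bTorsionTower` (the `Lines` original keeps `Summit.HodgeConjecture.HodgeConjecture.Cruxes.HLiu418.F0P6bBTSerreTateDefs`): every statement and every proof body is copied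
verbatim; ONLY the namespace, the three sibling imports (`Lines.F0_P6b_*` ↦ `Theorems.F0P6b*` twins) and the qualified sibling names are renamed,
so that `Theorems/` files (e.g. P6d's socket (b-p), `Theorems/F0P6dLubinTateFormalModuli.lean`) can import the P6b package without importing a
`Cruxes/…/Lines` module.  Sorry-free; axioms of every theorem = [propext, Classical.choice, Quot.sound].  HC_CM is proved only modulo the printed
citations until rung 0 closes; this twin changes no count (count-neutral ★ on `--supports stmt-HodgeConjecture-24832`). -/

/-!
# F0 · P6b — «BT groups & Serre–Tate» — §0 DEFS of the Serre–Tate package (DAYLIGHT re-cut, ED. 1)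

Crux workfile (target `Cruxes/HLiu418/Lines/F0_P6b_BTSerreTateDefs.lean`, BY WRITE on stmt-HodgeConjecture-24832 (HLiu418), route
HCCMUnconditional; cell hodgecm-mathlib, FLOOR 0, P6 «MOD programme», sub-desk P6b; desk F0P6b-plan (g12) DAYLIGHT candidate).
COUNT-NEUTRAL: HC_CM is proved only modulo the printed citations until rung 0 closes; nothing here changes that count.

WHY THIS FILE.  The parent `Lines/F0_P6b_BTSerreTate.lean` (ED. 4) carries the two banked sockets §1 `stub_L4B1u_abelianLiftOfIsUnitTwo`
and §2 `stub_L4B1es_serreTateLift`; the sub-lines `Lines/F0_P6b_MumfordDualFlat.lean` (FLATQUOT, ED. 1) and `Lines/F0_P6b_SerreTateSigma2.lean`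
(σ2, ED. 1) pay them BY TYPE modulo their banked `stub_*`, but IMPORT the parent (for this §0 predicate and the socket types), so the parent
cannot import them to pay §1 ∕ §2 BY TERM.  The DAYLIGHT re-cut («M-149e» (2)) inverts the edge: §0 moves DOWN into this defs-only file
(0 `sorry`, 1 `def` + 1 `theorem`, statement and body BYTE-IDENTICAL to the parent's ED. 4 §0), the sub-lines ED. 2 import THIS file instead of
the parent, and the parent ED. 5 imports the sub-lines and pays §1 ∕ §2 BY TERM (its §0 becomes `open … (IsTorsionTower)` onto this
constant, so every statement text of the parent stays byte-identical).  Module graph after the re-cut (acyclic):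
`F0_P6b_BTSerreTateDefs` ← `F0_P6b_MumfordDualFlat` ← `F0_P6b_SerreTateSigma2` ← `F0_P6b_BTSerreTate` (parent, 0 `sorry`).
No instance, no notation, no axiom, no `sorry`.

## References
* [Tate1967] J. Tate, *p-divisible groups*, Proc. Conf. Local Fields (Driebergen 1966), Springer 1967, §2 (2.1)–(2.2).
-/

set_option autoImplicit false
set_option linter.dupNamespace false  -- `Summit.HodgeConjecture.HodgeConjecture.…` BY DESIGN (D-0017), as in the parent line

open CategoryTheory CategoryTheory.Limits AlgebraicGeometry MonoidalCategory CartesianMonoidalCategory IsLocalRing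
open scoped MonObj

namespace Summit.HodgeConjecture.HodgeConjecture.Cruxes.HLiu418.F0P6bTorsionTower

open Literature.AlgebraicGeometry.GroupSchemes Literature.AlgebraicGeometry.AbelianSchemes

/-! ## §0 LOCAL SPEC predicate (moved verbatim from the parent `Lines/F0_P6b_BTSerreTate.lean` ED. 4 §0) -/

/-- **`i` exhibits the Barsotti–Tate group `B` as the `p`-divisible group `A[p^∞]` of the abelian scheme `A`** — the BODY of the ★
socket `BTGroup.IsOfAbelianScheme A B = ∃ i, …` as a predicate ON the kernel embeddings `i n : B.G n ⟶ A` (homomorphisms making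
`B.G n` the kernel of `[p^n]`, compatibly with the transitions), so that statements can NAME the embeddings (e.g. ★
`AbelianSchemeOver.torsionι` of ★ `pDivisibleGroup`, p844339) — the «kernel presentation» of ★
`BTGroup.existsUnique_hom_of_kernelPresentation`. [cite: Tate1967, §2 (2.1)] -/
def IsTorsionTower {S : Scheme.{0}} {p h : ℕ} (A : AbelianSchemeOver S) (B : BTGroup S p h) (i : ∀ n, B.G n ⟶ A.X) : Prop :=
  (∀ n, letI := B.grpObj n; IsMonHom (i n)) ∧
    (∀ n, IsPullback (i n) (toUnit (B.G n)) (((𝟙 A.X : A.X ⟶ A.X) ^ (p ^ n) : A.X ⟶ A.X)) η[A.X]) ∧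
    (∀ n, B.incl n ≫ i (n + 1) = i n)

/-- The ★ socket IS `∃ i, IsTorsionTower A B i` (by `Iff.rfl`). [cite: Tate1967, §2 (2.1)] -/
theorem isOfAbelianScheme_iff_exists_isTorsionTower {S : Scheme.{0}} {p h : ℕ} (A : AbelianSchemeOver S) (B : BTGroup S p h) :
    B.IsOfAbelianScheme A ↔ ∃ i, IsTorsionTower A B i :=
  Iff.rfl

end Summit.HodgeConjecture.HodgeConjecture.Cruxes.HLiu418.F0P6bTorsionTower
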